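import Summits.BirchSwinnertonDyer.BirchSwinnertonDyer.Theorems.KimAtThreeD7uTamagawaDefectTamDiv
import HarnessLib

/-!
# The TAMAGAWA-DIVISIBLE bad places, XIII-le / XV-le: the Tamagawa defect at every exponent with the
# LEVEL FAMILIES BOUNDED BY THE TARGET DEPTH — the CONSUMER forms of parts XIII and XV
# (cell `bsd-addord`, seat w2-tamdiv gen 7; route W2 `KimAtThreeKolyvagin`, items 19562 / 19679 / 19599 / 19560,
# «TamDiv∞»)

HONEST FRAMING: TOOL theorems (no definition, no named fact, no `sorry`); closes nothing by itself;
nothing is booked; BSD is not proved by any of this.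

## Why this file exists (a repair, stated plainly)

Parts XIII (`kolyvaginSystems_blochKatoUpdate_eq_bot`, p529599) and XV
(`kolyvaginSystems_blochKatoRelaxed_eq_bot_of_pow_succ_dvd`, p531036) — and through them parts XVII–XXI and
XXII §4 / XXIII — take their tower data in the shape of n1011's `TorsionLevel.apply_eq_zero_of_apply_eq_zero_allDepths`:
a family of Kolyvagin data `D j` on `E[3^j·3]` for EVERY `j : ℕ` on ONE prime set `P` with
`hD : ∀ j, (D j).HasCanonicalComparison (3^{j+1}) η` and `hadm : ∀ j, (D j).IsAdmissible`.  As n1011-p11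
recorded when landing the bounded form `TorsionLevel.apply_eq_zero_of_apply_eq_zero_allDepths_le`
(`GaloisImage/KolyvaginInjectivityAllDepthsLe.lean`): THAT OVER-ASKS — THE canonical comparison map at
level `3^{j+1}` exists at a prime `𝔮` only if `det(1 − Frob_𝔮 | E[3^{j+1}]) ≡ 0 (mod 3^{j+1})`
(`IsFiniteSingularComparisonWith.eval_one_comparisonP`), i.e. `3^{j+1} ∣ #Ẽ(𝔽_𝔮)`, which fails for every
fixed `𝔮` once `3^{j+1} > #Ẽ(𝔽_𝔮)`; so for a NON-EMPTY prime set the hypothesis `∀ j, hD j` is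
unsatisfiable and the unbounded statements, while correct, cannot be instantiated on any curve.  The proofs
of XIII/XV use the levels `j ≤ k` only.  This file re-proves them with `hD`, `hadm` asked for `j ≤ k` ONLY
(the data `D j`, `hP`, `hT`, `hτ`, `h0` may stay total: Kolyvagin data with primes `P` and cyclotomic
transverse conditions exist at every level, ONE `τ` serves all levels under the tower
(`S24Deep.exists_tau_forall_levels_of_towerSurj`), and `E[3^j·3]^{Γ_ℚ} = 0` under surj(3)) — the forms
END-level consumers must call.  Parts XVII–XXI admit the same mechanical restatement (not done here).

## What

* `kolyvaginSystems_blochKatoUpdate_eq_bot_le` — part XIII with `hD`/`hadm` for `j ≤ k`: `3 ∣ c_ℓ`,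
  `Φ_ℓ[3^k] ⊆ 3Φ_ℓ` ⇒ `KS(E[3^k·3], 𝓕_{u-ℓ}^{(k)}, D k) = 0` (same induction; the hypothesis of the step
  `k + 1` restricts to the one of `k`).
* `kolyvaginSystems_blochKatoUpdate_eq_bot_of_pow_succ_dvd_le`, **`kolyvaginSystems_blochKatoRelaxed_eq_bot_of_pow_succ_dvd_le`**,
  `isKolyvaginSystem_blochKatoRelaxed_apply_eq_zero_of_pow_succ_dvd_le` — part XV with the bounded families:
  **`3^{k+1} ∣ c_ℓ ⇒ KS(E[3^k·3], 𝓕_u, D k) = 0`** for [MR04] Remark A.5's `𝓕_u`.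

References: K. Büyükboduk, JNT 129 (2009) Prop. 2.7, Cor. 2.8, Thm. 3.1, Cor. 3.3; B. Mazur, K. Rubin,
Mem. AMS 799 (2004) Thm. 4.2.2, Prop. 6.2.6, App. A Remark A.5; R. Sakamoto, JTNB 36 (2024) Def. 3.5,
Thm. 4.4; K. Rubin, PCMI 18 (2011) Def. 1.9.6, Thm. 2.7.6.
-/

noncomputable section

-- the cell's Theorems namespace `Summit.BirchSwinnertonDyer.BirchSwinnertonDyer.…` repeats the summit name by design (D-0017)
set_option linter.dupNamespace false

open scoped Classical NumberField ContRepresentation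
open Function Field NumberField IsDedekindDomain Module
open WeierstrassCurve Literature.NumberTheory.EllipticCurves Literature.NumberTheory.GaloisRepresentations
  Literature.NumberTheory.GaloisRepresentations.DiscreteGaloisModule Literature.NumberTheory.GaloisCohomology
open Summit.BirchSwinnertonDyer.Rank1Residual.GaloisImage
open Summit.BirchSwinnertonDyer.Rank1Residual.GaloisImage.KSDevissage
open Summit.BirchSwinnertonDyer.Rank1Residual.GaloisImage.TorsionLevel
open Summit.BirchSwinnertonDyer.BirchSwinnertonDyer.Theorems.KimAtThreeD7uTamagawaCartesian
open Summit.BirchSwinnertonDyer.BirchSwinnertonDyer.Theorems.KimAtThreeD7uTamagawaDefect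
open Summit.BirchSwinnertonDyer.BirchSwinnertonDyer.Theorems.KimAtThreeD7uBlochKatoCondition
open Summit.BirchSwinnertonDyer.BirchSwinnertonDyer.Theorems.KimAtThreeD7uKolyvaginPairBlochKato
open Summit.BirchSwinnertonDyer.BirchSwinnertonDyer.Theorems.KimAtThreeD7uTamagawaFreeStructures

namespace Summit.BirchSwinnertonDyer.BirchSwinnertonDyer.Theorems.KimAtThreeD7uTamagawaDefectDevissage

section ExponentLe

variable (W : WeierstrassCurve ℚ) [W.IsElliptic]

/-- Local notation: `𝓕_{u-ℓ}^{(j)}` (as in parts XII–XIII). -/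
local notation3 "𝓕uℓ[" W' ", " ℓ' ", " j ", " L' "]" =>
  Function.update (propagatedSelmerStructure W' 3 j) (Sum.inr ℓ')
    (blochKatoSelmerStructure 3 (tateTorsionDatum W' 3 j) L' (Sum.inr ℓ'))

/-- **Part XIII with the level families bounded by the target depth** (`hD`, `hadm` for `j ≤ k` only; module
docstring): `3 ∣ c_ℓ ∧ Φ_ℓ[3^k] ⊆ 3Φ_ℓ ⇒ KS(E[3^k·3], 𝓕_{u-ℓ}^{(k)}, D k) = 0`.  Proof = part XIII's
induction verbatim, the bounded hypotheses of depth `k + 1` restricting to those of depth `k`.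
[cite: Buyukboduk2009TamagawaDefect, Cor. 2.8 and Thm. 3.1 (§§2.4, 3)] [cite: MazurRubin2004, Thm. 4.2.2, Prop. 6.2.6 and App. A Remark A.5]
[cite: Rubin2011, Def. 1.9.6 (p. 14)] -/
theorem kolyvaginSystems_blochKatoUpdate_eq_bot_le [Finite (geomTorsion W ((3 : ℕ) : ℤ))]
    [Finite (geomTorsion W (((3 : ℕ) : ℤ) ^ 0 * ((3 : ℕ) : ℤ)))]
    {inv : LocalInvariants ℚ 3}
    (hperf : inv.IsPerfect) (hsum : inv.SumLocalTermEqZero) (hcompl : inv.SelmerComplement)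
    (hEP : ∀ v : HeightOneSpectrum (𝓞 ℚ), localEulerPoincareCharacteristic (v.adicCompletion ℚ))
    (T : Finset (HeightOneSpectrum (𝓞 ℚ)))
    (h3T : ∀ v : HeightOneSpectrum (𝓞 ℚ), ((3 : ℕ) : 𝓞 ℚ) ∈ v.asIdeal → v ∈ T)
    (hbadT : ∀ v : HeightOneSpectrum (𝓞 ℚ), ¬ W.HasGoodReductionAt v → v ∈ T)
    {ℓ : HeightOneSpectrum (𝓞 ℚ)} (h3ℓ : ((3 : ℕ) : 𝓞 ℚ) ∉ ℓ.asIdeal)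
    (hc : 3 ∣ (W.baseChange (ℓ.adicCompletion ℚ)).localTamagawaNumber (ℓ.adicCompletionIntegers ℚ))
    (L : (j : ℕ) → (tateTorsionDatum W 3 j).LocalConditionsAbove 3)
    (h0 : ∀ (j : ℕ) (P : geomTorsion W (((3 : ℕ) : ℤ) ^ j * ((3 : ℕ) : ℤ))),
      (∀ σ : absoluteGaloisGroup ℚ,
        W.torsionGaloisModule (((3 : ℕ) : ℤ) ^ j * ((3 : ℕ) : ℤ)) σ P = P) → P = 0)
    {Sset : Set (HeightOneSpectrum (𝓞 ℚ))} {τ : absoluteGaloisGroup ℚ}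
    (hτ : ∀ j : ℕ, Nonempty (cokerSubOne (W.torsionGaloisModule (((3 : ℕ) : ℤ) ^ j * ((3 : ℕ) : ℤ))) τ ≃+
      ZMod (3 ^ (j + 1))))
    (hτ₁ : Nonempty (cokerSubOne (W.torsionGaloisModule ((3 : ℕ) : ℤ)) τ ≃+ ZMod 3))
    (D : (j : ℕ) → KolyvaginDatum (W.torsionGaloisModule (((3 : ℕ) : ℤ) ^ j * ((3 : ℕ) : ℤ))))
    {P : Set (HeightOneSpectrum (𝓞 ℚ))} (hP : ∀ j, (D j).primes = P) (hPT : ∀ q ∈ P, q ∉ T)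
    (hT : ∀ j, (D j).transverse = cyclotomicTransverse _)
    {η : (q : HeightOneSpectrum (𝓞 ℚ)) → (ZMod (Ideal.absNorm q.asIdeal))ˣ}
    (hprime : ∀ c : galoisCohomology (W.torsionGaloisModule (((3 : ℕ) : ℤ) ^ 0 * ((3 : ℕ) : ℤ))) 1, c ≠ 0 →
      ∀ c' : galoisCohomology (DiscreteGaloisModule.tateDual
        (W.torsionGaloisModule (((3 : ℕ) : ℤ) ^ 0 * ((3 : ℕ) : ℤ))) 3) 1, c' ≠ 0 →
      {q ∈ (D 0).primes |
        galoisCohomology.localization (W.torsionGaloisModule (((3 : ℕ) : ℤ) ^ 0 * ((3 : ℕ) : ℤ)))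
          (Sum.inr q) 1 c ≠ 0 ∧
        galoisCohomology.localization (DiscreteGaloisModule.tateDual
          (W.torsionGaloisModule (((3 : ℕ) : ℤ) ^ 0 * ((3 : ℕ) : ℤ))) 3) (Sum.inr q) 1 c' ≠ 0}.Infinite)
    (k : ℕ)
    -- the level families BOUNDED by the target depth `k` (the levels `> k` of `D` are never used)
    (hD : ∀ j, j ≤ k → (D j).HasCanonicalComparison (3 ^ (j + 1)) η) (hadm : ∀ j, j ≤ k → (D j).IsAdmissible)
    (hΦ : ∀ φ : ((W.localMinimalIntegralModel ℓ).baseChange (ℓ.adicCompletion ℚ)).toAffine.Point ⧸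
        (W.localMinimalIntegralModel ℓ).nonsingularReductionSubgroup
          (integers_valuationRing_valuation (ℓ.adicCompletionIntegers ℚ) (ℓ.adicCompletion ℚ)),
      3 ^ k • φ = 0 → ∃ ψ : ((W.localMinimalIntegralModel ℓ).baseChange (ℓ.adicCompletion ℚ)).toAffine.Point ⧸
        (W.localMinimalIntegralModel ℓ).nonsingularReductionSubgroup
          (integers_valuationRing_valuation (ℓ.adicCompletionIntegers ℚ) (ℓ.adicCompletion ℚ)),
        3 • ψ = φ)
    (hτμ : τ ∈ rootsOfUnityFixer ℚ (3 ^ (k + 1)))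
    (hPc : P ⊆ frobeniusClassPrimes
      (W.torsionGaloisModule (((3 : ℕ) : ℤ) ^ k * ((3 : ℕ) : ℤ))) Sset τ (3 ^ (k + 1))) :
    (D k).kolyvaginSystems 𝓕uℓ[W, ℓ, k, L k] = ⊥ := by
  haveI : Fact (Nat.Prime 3) := ⟨Nat.prime_three⟩
  -- `S = S(T)`; `ℓ ∈ T` (bad, since `c_ℓ ≠ 1`); the structures are unramified outside `S`
  have h3S : ∀ v : HeightOneSpectrum (𝓞 ℚ), ((3 : ℕ) : 𝓞 ℚ) ∈ v.asIdeal → (Sum.inr v : Place ℚ) ∈ finSupport T :=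
    fun v hv => (inr_mem_finSupport_iff T v).mpr (h3T v hv)
  have hbadS : ∀ v : HeightOneSpectrum (𝓞 ℚ), ¬ W.HasGoodReductionAt v → (Sum.inr v : Place ℚ) ∈ finSupport T :=
    fun v hv => (inr_mem_finSupport_iff T v).mpr (hbadT v hv)
  have h𝓕 : ∀ j : ℕ, (propagatedSelmerStructure W 3 j).IsUnramifiedOutside (finSupport T) := fun j =>
    propagatedSelmerStructure_isUnramifiedOutside W 3 j (finSupport T) (inl_mem_finSupport T) h3S hbadS
  have h𝓕₁ : (propagatedSelmerStructureOne W 3).IsUnramifiedOutside (finSupport T) := h𝓕 0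
  have hℓT : ℓ ∈ T := by
    refine hbadT ℓ fun hgood => ?_
    have h1 := localTamagawaNumber_eq_one_of_good_holds W ℓ hgood
    rw [h1] at hc
    exact absurd (Nat.dvd_one.mp hc) (by norm_num)
  have hℓS : (Sum.inr ℓ : Place ℚ) ∈ finSupport T := (inr_mem_finSupport_iff T ℓ).mpr hℓT
  have hPS : ∀ j, ∀ q ∈ (D j).primes, (Sum.inr q : Place ℚ) ∉ finSupport T := fun j q hq h =>
    hPT q ((hP j) ▸ hq) ((inr_mem_finSupport_iff T q).mp h)
  -- BASE (part IX): `KS(E[3^0·3], 𝓕_{u-ℓ}^{(0)}, D 0) = 0` whenever `P ⊆ 𝒫_3`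
  have hbase : P ⊆ frobeniusClassPrimes (W.torsionGaloisModule (((3 : ℕ) : ℤ) ^ 0 * ((3 : ℕ) : ℤ))) Sset τ
      (3 ^ (0 + 1)) → τ ∈ rootsOfUnityFixer ℚ (3 ^ (0 + 1)) → (D 0).IsAdmissible →
      (D 0).kolyvaginSystems 𝓕uℓ[W, ℓ, 0, L 0] = ⊥ := by
    intro hPc₀ hτμ₀ hadm₀
    have hprimeq : ∀ q : HeightOneSpectrum (𝓞 ℚ), Fact (Ideal.absNorm q.asIdeal).Prime :=
      fun q => ⟨FSComp.prime_absNorm_rat q⟩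
    have hne : ∀ q : HeightOneSpectrum (𝓞 ℚ),
        NeZero ((Ideal.absNorm q.asIdeal : ℕ) : q.adicCompletion ℚ) := fun q => by
      haveI : CharZero (q.adicCompletion ℚ) :=
        charZero_of_injective_algebraMap (algebraMap ℚ (q.adicCompletion ℚ)).injective
      exact ⟨Nat.cast_ne_zero.2 (FSComp.prime_absNorm_rat q).ne_zero⟩
    have hM₀ : ∀ m : geomTorsion W (((3 : ℕ) : ℤ) ^ 0 * ((3 : ℕ) : ℤ)), 3 ^ (0 + 1) • m = 0 :=
      pow_succ_nsmul_geomTorsion_eq_zero W 3 0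
    have hq₀ : ∀ q ∈ (D 0).primes, q ∈ frobeniusClassPrimes
        (W.torsionGaloisModule (((3 : ℕ) : ℤ) ^ 0 * ((3 : ℕ) : ℤ))) Sset τ (3 ^ (0 + 1)) :=
      fun q hq => hPc₀ ((hP 0) ▸ hq)
    have hM₀' : ∀ q ∈ (D 0).primes, ∀ m : geomTorsion W (((3 : ℕ) : ℤ) ^ 0 * ((3 : ℕ) : ℤ)),
        (Ideal.absNorm q.asIdeal - 1) • m = 0 := fun q hq =>
      absNorm_sub_one_smul_eq_zero_of_mem_frobeniusClassPrimes _ (hq₀ q hq) hτμ₀ hM₀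
    refine kolyvaginSystems_eq_bot_of_three_dvd_localTamagawaNumber W hperf hsum hcompl hEP T h3T hbadT
      h3ℓ hc (L 0) (𝓕₀ := 𝓕uℓ[W, ℓ, 0, L 0]) (fun v => ?_) ?_
      (fun q hq => hPT q ((hP 0) ▸ hq)) hadm₀ (fun q hq => ?_) (fun q hq => ?_) (fun q hq => ?_) hprime
    · -- `𝓕_{u-ℓ}^{(0)} ≤ 𝓕_can`
      by_cases hv : v = Sum.inr ℓ
      · subst hv
        rw [update_inr_apply_self]
        exact KimAtThreeD7uBlochKatoCondition.blochKatoSelmerStructure_inr_le_propagatedSelmerStructure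
          W 3 0 ℓ (L 0) h3ℓ
      · rw [update_inr_apply_of_ne _ ℓ _ hv]
    · rw [update_inr_apply_self]
    · have h := natCard_unramifiedSubgroup_toLocal_of_mem_frobeniusClassPrimes _ (hq₀ q hq) (hτ 0)
      simpa using h
    · haveI := hprimeq q; haveI := hne q
      rw [hT 0]
      have h := natCard_cyclotomicTransverse_rat_of_mem_frobeniusClassPrimes' _ (hq₀ q hq) (hτ 0) (hM₀' q hq)
      simpa using h
    · haveI := hprimeq q; haveI := hne q
      rw [hT 0]
      exact unramifiedSubgroup_sup_cyclotomicTransverse_eq_top_of_mem_frobeniusClassPrimes _ (hq₀ q hq)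
        (hM₀' q hq) (modPCyclotomicCharacter_surjOn_absInertia_rat_holds q)
  -- INDUCTION on `k`
  induction k with
  | zero => exact hbase hPc hτμ (hadm 0 le_rfl)
  | succ k ih =>
    have hdvd : 3 ^ (k + 1) ∣ 3 ^ (k + 1 + 1) := pow_dvd_pow 3 (Nat.le_succ _)
    have hdvd₀ : 3 ^ (0 + 1) ∣ 3 ^ (k + 1 + 1) := pow_dvd_pow 3 (by omega)
    have hker : ∀ u : absoluteGaloisGroup ℚ,
        W.torsionGaloisModule (((3 : ℕ) : ℤ) ^ (k + 1) * ((3 : ℕ) : ℤ)) u = 1 →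
          W.torsionGaloisModule (((3 : ℕ) : ℤ) ^ k * ((3 : ℕ) : ℤ)) u = 1 := fun u hu =>
      torsionGaloisModule_eq_one_of_dvd W (Transport.pow_mul_dvd_pow_mul (Nat.le_succ k)) u hu
    have hker₀ : ∀ u : absoluteGaloisGroup ℚ,
        W.torsionGaloisModule (((3 : ℕ) : ℤ) ^ (k + 1) * ((3 : ℕ) : ℤ)) u = 1 →
          W.torsionGaloisModule (((3 : ℕ) : ℤ) ^ 0 * ((3 : ℕ) : ℤ)) u = 1 := fun u hu =>
      torsionGaloisModule_eq_one_of_dvd W (Transport.pow_mul_dvd_pow_mul (Nat.zero_le (k + 1))) u hu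
    have hPc' : P ⊆ frobeniusClassPrimes (W.torsionGaloisModule (((3 : ℕ) : ℤ) ^ k * ((3 : ℕ) : ℤ)))
        Sset τ (3 ^ (k + 1)) := fun q hq =>
      S24Deep.frobeniusClassPrimes_mono _ _ hker Sset τ hdvd (hPc hq)
    have hPc₀ : P ⊆ frobeniusClassPrimes (W.torsionGaloisModule (((3 : ℕ) : ℤ) ^ 0 * ((3 : ℕ) : ℤ)))
        Sset τ (3 ^ (0 + 1)) := fun q hq =>
      S24Deep.frobeniusClassPrimes_mono _ _ hker₀ Sset τ hdvd₀ (hPc hq)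
    have hτμ' : τ ∈ rootsOfUnityFixer ℚ (3 ^ (k + 1)) := rootsOfUnityFixer_le_of_dvd ℚ hdvd hτμ
    have hτμ₀ : τ ∈ rootsOfUnityFixer ℚ (3 ^ (0 + 1)) := rootsOfUnityFixer_le_of_dvd ℚ hdvd₀ hτμ
    have hΦ' : ∀ φ : ((W.localMinimalIntegralModel ℓ).baseChange (ℓ.adicCompletion ℚ)).toAffine.Point ⧸
        (W.localMinimalIntegralModel ℓ).nonsingularReductionSubgroup
          (integers_valuationRing_valuation (ℓ.adicCompletionIntegers ℚ) (ℓ.adicCompletion ℚ)),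
        3 ^ k • φ = 0 → ∃ ψ : ((W.localMinimalIntegralModel ℓ).baseChange (ℓ.adicCompletion ℚ)).toAffine.Point ⧸
          (W.localMinimalIntegralModel ℓ).nonsingularReductionSubgroup
            (integers_valuationRing_valuation (ℓ.adicCompletionIntegers ℚ) (ℓ.adicCompletion ℚ)),
          3 • ψ = φ := fun φ hφ => hΦ φ (by rw [pow_succ, mul_comm, mul_smul, hφ, smul_zero])
    -- the two ends: `E[3^k·3]` by induction, `E[3] = E[3^0·3]` by the base
    have h₃ := ih (fun j hj => hD j (Nat.le_succ_of_le hj)) (fun j hj => hadm j (Nat.le_succ_of_le hj)) hΦ' hτμ' hPc'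
    have h₀ := hbase hPc₀ hτμ₀ (hadm 0 (Nat.zero_le _))
    -- the E[3]-end, read on `W.torsionGaloisModule 3` (definitionally `E[3^0·3]`)
    let F₁ : AddSubgroup (galoisCohomology ((W.torsionGaloisModule ((3 : ℕ) : ℤ)).toLocal (Sum.inr ℓ)) 1) :=
      @id (AddSubgroup (galoisCohomology ((W.torsionGaloisModule ((3 : ℕ) : ℤ)).toLocal (Sum.inr ℓ)) 1))
        (blochKatoSelmerStructure 3 (tateTorsionDatum W 3 0) (L 0) (Sum.inr ℓ))
    have h₁ : ∀ lam : Finset (HeightOneSpectrum (𝓞 ℚ)) →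
        galoisCohomology (W.torsionGaloisModule ((3 : ℕ) : ℤ)) 1,
        (D 0).IsKolyvaginSystem (Function.update (propagatedSelmerStructureOne W 3) (Sum.inr ℓ) F₁) lam →
          ∀ n, lam n = 0 := by
      intro lam hlam n
      have hmem : lam ∈ (D 0).kolyvaginSystems 𝓕uℓ[W, ℓ, 0, L 0] :=
        (KolyvaginDatum.mem_kolyvaginSystems_iff (D 0) 𝓕uℓ[W, ℓ, 0, L 0] lam).2 hlam
      exact congrFun ((AddSubgroup.eq_bot_iff_forall _).mp h₀ lam hmem) n
    refine (AddSubgroup.eq_bot_iff_forall _).mpr fun κ hκ => funext fun n => ?_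
    rw [Pi.zero_apply]
    exact apply_eq_zero_blochKatoUpdate_succ W k (h0 k) (h𝓕 (k + 1)) h𝓕₁ h3ℓ hℓS (L (k + 1)) (L k) F₁
      (fun x hx => mem_blochKatoSelmerStructure_of_localMap_torsionInclusion_mem_of_componentQuotient W 3
        (k + 1) ℓ h3ℓ (L 0) (L (k + 1)) hΦ x hx)
      hτμ (hτ (k + 1)) (hτ k) hτ₁ (D₁ := D 0) ((hP 0).trans (hP (k + 1)).symm)
      ((hP k).trans (hP (k + 1)).symm) (by rw [hP (k + 1)]; exact hPc) (hPS (k + 1)) (hT (k + 1)) (hT k)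
      (hT 0) (hD (k + 1) le_rfl) (hD k (Nat.le_succ k)) (hD 0 (Nat.zero_le _)) (hadm (k + 1) le_rfl) h₁
      (fun μ hμ m => congrFun ((AddSubgroup.eq_bot_iff_forall _).mp h₃ μ
        ((KolyvaginDatum.mem_kolyvaginSystems_iff (D k) 𝓕uℓ[W, ℓ, k, L k] μ).2 hμ)) m)
      ((KolyvaginDatum.mem_kolyvaginSystems_iff _ _ _).1 hκ) n


/-- **Part XV §2 with the bounded families: `3^{k+1} ∣ c_ℓ ⇒ KS(E[3^k·3], 𝓕_{u-ℓ}^{(k)}, D k) = 0`**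
(both local hypotheses of XIII-le discharged by Kodaira–Néron, part XIV).
[cite: Buyukboduk2009TamagawaDefect, Cor. 2.8, Thm. 3.1 and Cor. 3.3] [cite: MazurRubin2004, Prop. 6.2.6 and App. A Remark A.5] -/
theorem kolyvaginSystems_blochKatoUpdate_eq_bot_of_pow_succ_dvd_le [Finite (geomTorsion W ((3 : ℕ) : ℤ))]
    [Finite (geomTorsion W (((3 : ℕ) : ℤ) ^ 0 * ((3 : ℕ) : ℤ)))]
    {inv : LocalInvariants ℚ 3}
    (hperf : inv.IsPerfect) (hsum : inv.SumLocalTermEqZero) (hcompl : inv.SelmerComplement)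
    (hEP : ∀ v : HeightOneSpectrum (𝓞 ℚ), localEulerPoincareCharacteristic (v.adicCompletion ℚ))
    (T : Finset (HeightOneSpectrum (𝓞 ℚ)))
    (h3T : ∀ v : HeightOneSpectrum (𝓞 ℚ), ((3 : ℕ) : 𝓞 ℚ) ∈ v.asIdeal → v ∈ T)
    (hbadT : ∀ v : HeightOneSpectrum (𝓞 ℚ), ¬ W.HasGoodReductionAt v → v ∈ T)
    {ℓ : HeightOneSpectrum (𝓞 ℚ)} (h3ℓ : ((3 : ℕ) : 𝓞 ℚ) ∉ ℓ.asIdeal) (k : ℕ)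
    (hk : 3 ^ (k + 1) ∣ (W.baseChange (ℓ.adicCompletion ℚ)).localTamagawaNumber (ℓ.adicCompletionIntegers ℚ))
    (L : (j : ℕ) → (tateTorsionDatum W 3 j).LocalConditionsAbove 3)
    (h0 : ∀ (j : ℕ) (P : geomTorsion W (((3 : ℕ) : ℤ) ^ j * ((3 : ℕ) : ℤ))),
      (∀ σ : absoluteGaloisGroup ℚ,
        W.torsionGaloisModule (((3 : ℕ) : ℤ) ^ j * ((3 : ℕ) : ℤ)) σ P = P) → P = 0)
    {Sset : Set (HeightOneSpectrum (𝓞 ℚ))} {τ : absoluteGaloisGroup ℚ}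
    (hτ : ∀ j : ℕ, Nonempty (cokerSubOne (W.torsionGaloisModule (((3 : ℕ) : ℤ) ^ j * ((3 : ℕ) : ℤ))) τ ≃+
      ZMod (3 ^ (j + 1))))
    (hτ₁ : Nonempty (cokerSubOne (W.torsionGaloisModule ((3 : ℕ) : ℤ)) τ ≃+ ZMod 3))
    (hτμ : τ ∈ rootsOfUnityFixer ℚ (3 ^ (k + 1)))
    (D : (j : ℕ) → KolyvaginDatum (W.torsionGaloisModule (((3 : ℕ) : ℤ) ^ j * ((3 : ℕ) : ℤ))))
    {P : Set (HeightOneSpectrum (𝓞 ℚ))} (hP : ∀ j, (D j).primes = P) (hPT : ∀ q ∈ P, q ∉ T)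
    (hPc : P ⊆ frobeniusClassPrimes
      (W.torsionGaloisModule (((3 : ℕ) : ℤ) ^ k * ((3 : ℕ) : ℤ))) Sset τ (3 ^ (k + 1)))
    (hT : ∀ j, (D j).transverse = cyclotomicTransverse _)
    {η : (q : HeightOneSpectrum (𝓞 ℚ)) → (ZMod (Ideal.absNorm q.asIdeal))ˣ}
    (hD : ∀ j, j ≤ k → (D j).HasCanonicalComparison (3 ^ (j + 1)) η)
    (hadm : ∀ j, j ≤ k → (D j).IsAdmissible)
    (hprime : ∀ c : galoisCohomology (W.torsionGaloisModule (((3 : ℕ) : ℤ) ^ 0 * ((3 : ℕ) : ℤ))) 1, c ≠ 0 →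
      ∀ c' : galoisCohomology (DiscreteGaloisModule.tateDual
        (W.torsionGaloisModule (((3 : ℕ) : ℤ) ^ 0 * ((3 : ℕ) : ℤ))) 3) 1, c' ≠ 0 →
      {q ∈ (D 0).primes |
        galoisCohomology.localization (W.torsionGaloisModule (((3 : ℕ) : ℤ) ^ 0 * ((3 : ℕ) : ℤ)))
          (Sum.inr q) 1 c ≠ 0 ∧
        galoisCohomology.localization (DiscreteGaloisModule.tateDual
          (W.torsionGaloisModule (((3 : ℕ) : ℤ) ^ 0 * ((3 : ℕ) : ℤ))) 3) (Sum.inr q) 1 c' ≠ 0}.Infinite) :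
    (D k).kolyvaginSystems 𝓕uℓ[W, ℓ, k, L k] = ⊥ := by
  haveI : Fact (Nat.Prime 3) := ⟨Nat.prime_three⟩
  have hc : 3 ∣ (W.baseChange (ℓ.adicCompletion ℚ)).localTamagawaNumber (ℓ.adicCompletionIntegers ℚ) :=
    (dvd_pow_self 3 (Nat.succ_ne_zero k)).trans hk
  exact kolyvaginSystems_blochKatoUpdate_eq_bot_le W hperf hsum hcompl hEP T h3T hbadT h3ℓ hc L h0 hτ hτ₁ D
    hP hPT hT hprime k hD hadm
    (componentQuotient_torsionBy_le_smul_of_pow_succ_dvd W 3 k ℓ (by norm_num) hk) hτμ hPc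

/-- **«TamDiv∞» at Kolyvagin-system level, CONSUMER FORM: `3^{k+1} ∣ c_ℓ ⇒ KS(E[3^k·3], 𝓕_u, D k) = 0`**
for [MR04] Remark A.5's structure `𝓕_u = blochKatoSelmerStructure 3 (tateTorsionDatum W 3 k) ⊤`, with the
canonical data asked for `j ≤ k` only (part XV §3 verbatim otherwise: §2-le + part XV §1 + monotonicity of
`KS` in the structure, part IX). [cite: Buyukboduk2009TamagawaDefect, Thm. 3.1 and Cor. 3.3]
[cite: MazurRubin2004, App. A Remark A.5 (p. 81)] -/
theorem kolyvaginSystems_blochKatoRelaxed_eq_bot_of_pow_succ_dvd_le [Finite (geomTorsion W ((3 : ℕ) : ℤ))]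
    [Finite (geomTorsion W (((3 : ℕ) : ℤ) ^ 0 * ((3 : ℕ) : ℤ)))]
    {inv : LocalInvariants ℚ 3}
    (hperf : inv.IsPerfect) (hsum : inv.SumLocalTermEqZero) (hcompl : inv.SelmerComplement)
    (hEP : ∀ v : HeightOneSpectrum (𝓞 ℚ), localEulerPoincareCharacteristic (v.adicCompletion ℚ))
    (T : Finset (HeightOneSpectrum (𝓞 ℚ)))
    (h3T : ∀ v : HeightOneSpectrum (𝓞 ℚ), ((3 : ℕ) : 𝓞 ℚ) ∈ v.asIdeal → v ∈ T)
    (hbadT : ∀ v : HeightOneSpectrum (𝓞 ℚ), ¬ W.HasGoodReductionAt v → v ∈ T)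
    {ℓ : HeightOneSpectrum (𝓞 ℚ)} (h3ℓ : ((3 : ℕ) : 𝓞 ℚ) ∉ ℓ.asIdeal) (k : ℕ)
    (hk : 3 ^ (k + 1) ∣ (W.baseChange (ℓ.adicCompletion ℚ)).localTamagawaNumber (ℓ.adicCompletionIntegers ℚ))
    (h0 : ∀ (j : ℕ) (P : geomTorsion W (((3 : ℕ) : ℤ) ^ j * ((3 : ℕ) : ℤ))),
      (∀ σ : absoluteGaloisGroup ℚ,
        W.torsionGaloisModule (((3 : ℕ) : ℤ) ^ j * ((3 : ℕ) : ℤ)) σ P = P) → P = 0)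
    {Sset : Set (HeightOneSpectrum (𝓞 ℚ))} {τ : absoluteGaloisGroup ℚ}
    (hτ : ∀ j : ℕ, Nonempty (cokerSubOne (W.torsionGaloisModule (((3 : ℕ) : ℤ) ^ j * ((3 : ℕ) : ℤ))) τ ≃+
      ZMod (3 ^ (j + 1))))
    (hτ₁ : Nonempty (cokerSubOne (W.torsionGaloisModule ((3 : ℕ) : ℤ)) τ ≃+ ZMod 3))
    (hτμ : τ ∈ rootsOfUnityFixer ℚ (3 ^ (k + 1)))
    (D : (j : ℕ) → KolyvaginDatum (W.torsionGaloisModule (((3 : ℕ) : ℤ) ^ j * ((3 : ℕ) : ℤ))))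
    {P : Set (HeightOneSpectrum (𝓞 ℚ))} (hP : ∀ j, (D j).primes = P) (hPT : ∀ q ∈ P, q ∉ T)
    (hPc : P ⊆ frobeniusClassPrimes
      (W.torsionGaloisModule (((3 : ℕ) : ℤ) ^ k * ((3 : ℕ) : ℤ))) Sset τ (3 ^ (k + 1)))
    (hT : ∀ j, (D j).transverse = cyclotomicTransverse _)
    {η : (q : HeightOneSpectrum (𝓞 ℚ)) → (ZMod (Ideal.absNorm q.asIdeal))ˣ}
    (hD : ∀ j, j ≤ k → (D j).HasCanonicalComparison (3 ^ (j + 1)) η)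
    (hadm : ∀ j, j ≤ k → (D j).IsAdmissible)
    (hprime : ∀ c : galoisCohomology (W.torsionGaloisModule (((3 : ℕ) : ℤ) ^ 0 * ((3 : ℕ) : ℤ))) 1, c ≠ 0 →
      ∀ c' : galoisCohomology (DiscreteGaloisModule.tateDual
        (W.torsionGaloisModule (((3 : ℕ) : ℤ) ^ 0 * ((3 : ℕ) : ℤ))) 3) 1, c' ≠ 0 →
      {q ∈ (D 0).primes |
        galoisCohomology.localization (W.torsionGaloisModule (((3 : ℕ) : ℤ) ^ 0 * ((3 : ℕ) : ℤ)))
          (Sum.inr q) 1 c ≠ 0 ∧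
        galoisCohomology.localization (DiscreteGaloisModule.tateDual
          (W.torsionGaloisModule (((3 : ℕ) : ℤ) ^ 0 * ((3 : ℕ) : ℤ))) 3) (Sum.inr q) 1 c' ≠ 0}.Infinite) :
    (D k).kolyvaginSystems (blochKatoSelmerStructure 3 (tateTorsionDatum W 3 k) (fun _ _ => ⊤)) = ⊥ := by
  haveI : Fact (Nat.Prime 3) := ⟨Nat.prime_three⟩
  have h := kolyvaginSystems_blochKatoUpdate_eq_bot_of_pow_succ_dvd_le W hperf hsum hcompl hEP T h3T hbadT h3ℓ
    k hk (fun j => fun _ _ => ⊤) h0 hτ hτ₁ hτμ D hP hPT hPc hT hD hadm hprime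
  exact le_bot_iff.mp ((kolyvaginSystems_mono (D k)
    (blochKatoSelmerStructure_relaxed_le_blochKatoUpdate W 3 k (by norm_num) ℓ)).trans h.le)

/-- **Element form (consumer form)**: every class of a Kolyvagin system for `𝓕_u` on `E[3^{k+1}]` VANISHES
when `3^{k+1} ∣ c_ℓ` (`ℓ ∤ 3`), the canonical data asked for `j ≤ k` only.
[cite: Buyukboduk2009TamagawaDefect, Thm. 3.1 and Cor. 3.3] [cite: MazurRubin2004, Prop. 6.2.6 and App. A Remark A.5] -/
theorem isKolyvaginSystem_blochKatoRelaxed_apply_eq_zero_of_pow_succ_dvd_le [Finite (geomTorsion W ((3 : ℕ) : ℤ))]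
    [Finite (geomTorsion W (((3 : ℕ) : ℤ) ^ 0 * ((3 : ℕ) : ℤ)))]
    {inv : LocalInvariants ℚ 3}
    (hperf : inv.IsPerfect) (hsum : inv.SumLocalTermEqZero) (hcompl : inv.SelmerComplement)
    (hEP : ∀ v : HeightOneSpectrum (𝓞 ℚ), localEulerPoincareCharacteristic (v.adicCompletion ℚ))
    (T : Finset (HeightOneSpectrum (𝓞 ℚ)))
    (h3T : ∀ v : HeightOneSpectrum (𝓞 ℚ), ((3 : ℕ) : 𝓞 ℚ) ∈ v.asIdeal → v ∈ T)
    (hbadT : ∀ v : HeightOneSpectrum (𝓞 ℚ), ¬ W.HasGoodReductionAt v → v ∈ T)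
    {ℓ : HeightOneSpectrum (𝓞 ℚ)} (h3ℓ : ((3 : ℕ) : 𝓞 ℚ) ∉ ℓ.asIdeal) (k : ℕ)
    (hk : 3 ^ (k + 1) ∣ (W.baseChange (ℓ.adicCompletion ℚ)).localTamagawaNumber (ℓ.adicCompletionIntegers ℚ))
    (h0 : ∀ (j : ℕ) (P : geomTorsion W (((3 : ℕ) : ℤ) ^ j * ((3 : ℕ) : ℤ))),
      (∀ σ : absoluteGaloisGroup ℚ,
        W.torsionGaloisModule (((3 : ℕ) : ℤ) ^ j * ((3 : ℕ) : ℤ)) σ P = P) → P = 0)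
    {Sset : Set (HeightOneSpectrum (𝓞 ℚ))} {τ : absoluteGaloisGroup ℚ}
    (hτ : ∀ j : ℕ, Nonempty (cokerSubOne (W.torsionGaloisModule (((3 : ℕ) : ℤ) ^ j * ((3 : ℕ) : ℤ))) τ ≃+
      ZMod (3 ^ (j + 1))))
    (hτ₁ : Nonempty (cokerSubOne (W.torsionGaloisModule ((3 : ℕ) : ℤ)) τ ≃+ ZMod 3))
    (hτμ : τ ∈ rootsOfUnityFixer ℚ (3 ^ (k + 1)))
    (D : (j : ℕ) → KolyvaginDatum (W.torsionGaloisModule (((3 : ℕ) : ℤ) ^ j * ((3 : ℕ) : ℤ))))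
    {P : Set (HeightOneSpectrum (𝓞 ℚ))} (hP : ∀ j, (D j).primes = P) (hPT : ∀ q ∈ P, q ∉ T)
    (hPc : P ⊆ frobeniusClassPrimes
      (W.torsionGaloisModule (((3 : ℕ) : ℤ) ^ k * ((3 : ℕ) : ℤ))) Sset τ (3 ^ (k + 1)))
    (hT : ∀ j, (D j).transverse = cyclotomicTransverse _)
    {η : (q : HeightOneSpectrum (𝓞 ℚ)) → (ZMod (Ideal.absNorm q.asIdeal))ˣ}
    (hD : ∀ j, j ≤ k → (D j).HasCanonicalComparison (3 ^ (j + 1)) η)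
    (hadm : ∀ j, j ≤ k → (D j).IsAdmissible)
    (hprime : ∀ c : galoisCohomology (W.torsionGaloisModule (((3 : ℕ) : ℤ) ^ 0 * ((3 : ℕ) : ℤ))) 1, c ≠ 0 →
      ∀ c' : galoisCohomology (DiscreteGaloisModule.tateDual
        (W.torsionGaloisModule (((3 : ℕ) : ℤ) ^ 0 * ((3 : ℕ) : ℤ))) 3) 1, c' ≠ 0 →
      {q ∈ (D 0).primes |
        galoisCohomology.localization (W.torsionGaloisModule (((3 : ℕ) : ℤ) ^ 0 * ((3 : ℕ) : ℤ)))
          (Sum.inr q) 1 c ≠ 0 ∧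
        galoisCohomology.localization (DiscreteGaloisModule.tateDual
          (W.torsionGaloisModule (((3 : ℕ) : ℤ) ^ 0 * ((3 : ℕ) : ℤ))) 3) (Sum.inr q) 1 c' ≠ 0}.Infinite)
    {κ : Finset (HeightOneSpectrum (𝓞 ℚ)) →
      galoisCohomology (W.torsionGaloisModule (((3 : ℕ) : ℤ) ^ k * ((3 : ℕ) : ℤ))) 1}
    (hκ : (D k).IsKolyvaginSystem (blochKatoSelmerStructure 3 (tateTorsionDatum W 3 k) (fun _ _ => ⊤)) κ)
    (d : Finset (HeightOneSpectrum (𝓞 ℚ))) : κ d = 0 := by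
  have h := kolyvaginSystems_blochKatoRelaxed_eq_bot_of_pow_succ_dvd_le W hperf hsum hcompl hEP T h3T hbadT h3ℓ
    k hk h0 hτ hτ₁ hτμ D hP hPT hPc hT hD hadm hprime
  exact congrFun ((AddSubgroup.eq_bot_iff_forall _).mp h κ
    ((KolyvaginDatum.mem_kolyvaginSystems_iff _ _ _).2 hκ)) d

end ExponentLe

end Summit.BirchSwinnertonDyer.BirchSwinnertonDyer.Theorems.KimAtThreeD7uTamagawaDefectDevissage

end
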